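import Literature.Geometry.Lorentzian.KerrExactRegionFacts
import Literature.Geometry.Lorentzian.KerrRegionIIDiameter
import HarnessLib

/-!
# Discharge of the named fact `KerrBlackHoleBoundedTimeSeparation`

(family `gr`; namespace `Literature.Geometry.Lorentzian`)

The named fact `KerrBlackHoleBoundedTimeSeparation` of `KerrExactRegionFacts.lean` (finite
timelike diameter of Boyer–Lindquist block II of a sub-extremal Kerr black hole, read in the
ingoing Kerr–Schild chart `Kerr.spacetime M a r₋ hM`: `d(p, q) ≤ C(M, a)` whenever `r(p) < r₊`)
is PROVED here: it is the tree theorem `Kerr.lorentzDist_le_of_radius_lt_rPlus`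
(`KerrRegionIIDiameter.lean`: `r` is a bounded clock on block II, the reverse Cauchy–Schwarz
speed bound, and the fundamental theorem of calculus along future causal curves), with the
explicit constant `C = √(r₊² + a²) · regionIIClockBound r₋ r₊`.

## References

* B. O'Neill, *The Geometry of Kerr Black Holes*, A K Peters 1995, Ch. 2, §2.5; Ch. 4, §4.2.
  Key `ONeill1995`.
* S. W. Hawking, G. F. R. Ellis, *The large scale structure of space-time*, CUP 1973, §5.6.
  Key `HawkingEllis1973CUP`.
-/

noncomputable section

open scoped ENNReal NNReal

namespace Literature.Geometry.Lorentzian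

/-- **Boyer–Lindquist block II of sub-extremal Kerr has finite timelike diameter** — the named
fact `KerrBlackHoleBoundedTimeSeparation` holds: for `|a| < M`, with
`C = √(r₊² + a²) · regionIIClockBound r₋ r₊`, every `p` with `r(p) < r₊` and every `q` of the
chart `{r > r₋}` satisfy `d(p, q) ≤ C` (`Kerr.lorentzDist_le_of_radius_lt_rPlus`).
O'Neill 1995, Ch. 2, §2.5 and Ch. 4, §4.2. [cite: ONeill1995, Ch. 2, §2.5 and Ch. 4, §4.2] -/
theorem KerrBlackHoleBoundedTimeSeparation_holds : KerrBlackHoleBoundedTimeSeparation := by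
  intro _ M a hM h
  refine ⟨(Real.sqrt (Kerr.rPlus M a ^ 2 + a ^ 2) *
    Kerr.regionIIClockBound (Kerr.rMinus M a) (Kerr.rPlus M a)).toNNReal, fun p q hp ↦ ?_⟩
  exact Kerr.lorentzDist_le_of_radius_lt_rPlus h hM p q hp

end Literature.Geometry.Lorentzian

end
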